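import Mathlib
import Literature.Computability.Complexity.Circuit
import Summits.PneNP.PneNP.Theorems.ConvexRankGatesConvexGateBlindBlocks

/-!
# PneNP / ConvexRankGates — `ConvexGateBlind`: homogenising a circuit of CONV gates

Helpers (`--supports stmt-PneNP-10680`) for the single-gate collapse
(`ConvexRankGatesConvexGateBlindCollapse.lean`). A CONV gate of the route is
`v ↦ [∃ Y ⪰ 0 (q × q), ∀ i < p, tr(Aᵢ Y) ≤ bᵢ + ∑ⱼ Bᵢⱼ [vⱼ]]` with `B ≥ 0`, `p + q ≤ s`.
* `gate_normalForm`: every gate of `{∧₂, ∨₂} ∪ CONV_s` is a CONV gate with exactly `s + 1` rows and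
  an `(s+1) × (s+1)` PSD variable (`∧₂`, `∨₂` are non-negative threshold rows; zero padding).
* `collapse_sound` / `collapse_complete`: the HOMOGENISED system of a circuit — gate `j` gets a
  scalar `zⱼ ≥ 0` and its programme is multiplied by `zⱼ` (`tr(Aⱼᵢ Ybⱼ) ≤ bⱼᵢ zⱼ + ∑ₐ Bⱼᵢₐ w_{j,ref a}`),
  the products `zⱼ · [wire r]` are linearised by `w_{j,r} ≤ zⱼ`, `w_{j,e} ≤ [xₑ]`, `w_{j,m} ≤ z_m` —
  is sound (`zⱼ > 0 ⇒` wire `j` true: divide by `zⱼ`, use `B ≥ 0`, induct along the wire order)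
  and complete (the 0/1 point of the true transcript is feasible with `zⱼ = 1` on true wires).
  Both are stated abstractly over the gate data and the transcript equations, so that the circuit
  enters only through `W j = opⱼ (values of its argument wires)`.
-/

namespace Summit.PneNP.PneNP.Theorems

open Matrix Finset

/-! ### Gate normal form: every basis gate is a CONV gate with `s+1` rows and an `(s+1)×(s+1)` block -/

section normalForm

open Literature.Computability.Complexity

/-- A non-negative threshold row `0 ≤ θ + ∑ⱼ [vⱼ]` as a CONV programme with `s+1` rows and an
`(s+1) × (s+1)` PSD variable (all `Aᵢ = 0`; row `0` carries the threshold, the others are `0 ≤ 0`). [folklore] -/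
theorem threshold_normalForm (s n : ℕ) (θ : ℝ) :
    ∃ (A : Fin (s + 1) → Matrix (Fin (s + 1)) (Fin (s + 1)) ℝ) (b : Fin (s + 1) → ℝ)
      (B : Fin (s + 1) → Fin n → ℝ), (∀ i j, 0 ≤ B i j) ∧ ∀ v : Fin n → Bool,
        (0 ≤ θ + ∑ j, (if v j then (1 : ℝ) else 0)) ↔
        ∃ Y : Matrix (Fin (s + 1)) (Fin (s + 1)) ℝ, Y.PosSemidef ∧
          ∀ i, (A i * Y).trace ≤ b i + ∑ j, B i j * (if v j then (1 : ℝ) else 0) := by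
  refine ⟨fun _ => 0, fun i => if i = 0 then θ else 0, fun i _ => if i = 0 then 1 else 0,
    fun i j => ?_, fun v => ⟨fun hv => ⟨0, Matrix.PosSemidef.zero, fun i => ?_⟩, ?_⟩⟩
  · dsimp only
    split_ifs <;> norm_num
  · rw [Matrix.zero_mul, Matrix.trace_zero]
    by_cases hi : i = 0
    · simp only [hi, if_true, one_mul]
      exact hv
    · simp only [hi, if_false, zero_mul, Finset.sum_const_zero, add_zero]
      exact le_refl _
  · rintro ⟨Y, -, hY⟩
    have h0 := hY 0
    simp only [Matrix.zero_mul, Matrix.trace_zero, if_true, one_mul] at h0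
    exact h0

/-- **Gate normal form.** Every gate of the basis `{∧₂, ∨₂} ∪ CONV_s` is a CONV gate with exactly
`s + 1` rows and an `(s+1) × (s+1)` PSD variable: `∧₂`/`∨₂` are the threshold rows
`0 ≤ -2 + [v₀] + [v₁]` / `0 ≤ -1 + [v₀] + [v₁]`, and a CONV gate with `p + q ≤ s` is zero-padded
(`conv_feasible_pad`). [folklore] -/
theorem gate_normalForm {s : ℕ} {g : GateFn}
    (hg : g ∈ ({GateFn.and 2, GateFn.or 2} : Set GateFn) ∪
      {g | ∃ (p q : ℕ), p + q ≤ s ∧ ∃ (A : Fin p → Matrix (Fin q) (Fin q) ℝ) (b : Fin p → ℝ)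
        (B : Fin p → Fin g.1 → ℝ), (∀ i j, 0 ≤ B i j) ∧ ∀ v : Fin g.1 → Bool, g.2 v = true ↔
          ∃ Y : Matrix (Fin q) (Fin q) ℝ, Y.PosSemidef ∧
            ∀ i, (A i * Y).trace ≤ b i + ∑ j, B i j * (if v j then (1 : ℝ) else 0)}) :
    ∃ (A : Fin (s + 1) → Matrix (Fin (s + 1)) (Fin (s + 1)) ℝ) (b : Fin (s + 1) → ℝ)
      (B : Fin (s + 1) → Fin g.1 → ℝ), (∀ i j, 0 ≤ B i j) ∧ ∀ v : Fin g.1 → Bool, g.2 v = true ↔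
        ∃ Y : Matrix (Fin (s + 1)) (Fin (s + 1)) ℝ, Y.PosSemidef ∧
          ∀ i, (A i * Y).trace ≤ b i + ∑ j, B i j * (if v j then (1 : ℝ) else 0) := by
  rcases hg with hg | ⟨p, q, hpq, A, b, B, hB, hiff⟩
  · simp only [Set.mem_insert_iff, Set.mem_singleton_iff] at hg
    rcases hg with rfl | rfl
    · obtain ⟨A, b, B, hB, hiff⟩ := threshold_normalForm s 2 (-2)
      refine ⟨A, b, B, hB, ?_⟩
      show ∀ v : Fin 2 → Bool, _
      intro v
      refine Iff.trans ?_ (hiff v)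
      show decide (∀ i : Fin 2, v i = true) = true ↔ (0 : ℝ) ≤ -2 + ∑ j : Fin 2, (if v j then (1 : ℝ) else 0)
      simp only [decide_eq_true_eq, Fin.forall_fin_two, Fin.sum_univ_two]
      cases v 0 <;> cases v 1 <;> norm_num
    · obtain ⟨A, b, B, hB, hiff⟩ := threshold_normalForm s 2 (-1)
      refine ⟨A, b, B, hB, ?_⟩
      show ∀ v : Fin 2 → Bool, _
      intro v
      refine Iff.trans ?_ (hiff v)
      show decide (∃ i : Fin 2, v i = true) = true ↔ (0 : ℝ) ≤ -1 + ∑ j : Fin 2, (if v j then (1 : ℝ) else 0)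
      simp only [decide_eq_true_eq, Fin.exists_fin_two, Fin.sum_univ_two]
      cases v 0 <;> cases v 1 <;> norm_num
  · have hp : p ≤ s + 1 := by omega
    have hq : q ≤ s + 1 := by omega
    obtain ⟨A', hA'⟩ := conv_feasible_pad hp hq A
    refine ⟨A', fun i => if h : i.val < p then b ⟨i, h⟩ else 0,
      fun i j => if h : i.val < p then B ⟨i, h⟩ j else 0, fun i j => ?_, fun v => ?_⟩
    · dsimp only
      split_ifs with h
      · exact hB _ _
      · exact le_refl _
    · rw [hiff v, hA' (fun i => b i + ∑ j, B i j * (if v j then (1 : ℝ) else 0))]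
      refine exists_congr fun Y' => and_congr Iff.rfl (forall_congr' fun i => ?_)
      dsimp only
      by_cases h : i.val < p
      · simp only [dif_pos h]
      · simp only [dif_neg h, zero_mul, Finset.sum_const_zero, add_zero]

end normalForm

/-! ### The homogenised system: abstract soundness and completeness -/

section semantics

variable {ι : Type*} {t s₁ : ℕ}

/-- **Soundness of the homogenised system.** Gates `j < t` with CONV data `(Aⱼ, bⱼ, Bⱼ)`, argument
wires `ref j a` (inputs or EARLIER gates), true wire values `W` (the transcript: `W j = opⱼ` of its
argument values). If scalars `z ≥ 0`, `w` and PSD blocks `Ybⱼ` satisfy the homogenised rows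
`tr(Aⱼᵢ Ybⱼ) ≤ bⱼᵢ zⱼ + ∑ₐ Bⱼᵢₐ w_{j, ref a}`, `w_{j,r} ≤ zⱼ`, `w_{j,e} ≤ [xₑ]`, `w_{j,m} ≤ z_m`, then
`zⱼ > 0` forces wire `j` to be true (divide by `zⱼ`; induction along the wire order). [folklore] -/
theorem collapse_sound (ar : Fin t → ℕ) (op : (j : Fin t) → (Fin (ar j) → Bool) → Bool)
    (ref : (j : Fin t) → Fin (ar j) → ι ⊕ Fin t)
    (href : ∀ j a m, ref j a = Sum.inr m → m < j)
    (A : Fin t → Fin s₁ → Matrix (Fin s₁) (Fin s₁) ℝ) (b : Fin t → Fin s₁ → ℝ)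
    (B : (j : Fin t) → Fin s₁ → Fin (ar j) → ℝ) (hB : ∀ j i a, 0 ≤ B j i a)
    (hiff : ∀ j u, op j u = true ↔ ∃ Y : Matrix (Fin s₁) (Fin s₁) ℝ, Y.PosSemidef ∧
      ∀ i, (A j i * Y).trace ≤ b j i + ∑ a, B j i a * (if u a then (1 : ℝ) else 0))
    (x : ι → Bool) (W : Fin t → Bool) (hW : ∀ j, W j = op j (fun a => Sum.elim x W (ref j a)))
    (z : Fin t → ℝ) (w : Fin t → ι ⊕ Fin t → ℝ) (Yb : Fin t → Matrix (Fin s₁) (Fin s₁) ℝ)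
    (hz : ∀ j, 0 ≤ z j) (hYb : ∀ j, (Yb j).PosSemidef)
    (h1 : ∀ j i, (A j i * Yb j).trace ≤ b j i * z j + ∑ a, B j i a * w j (ref j a))
    (h2 : ∀ j r, w j r ≤ z j)
    (h3 : ∀ j e, w j (Sum.inl e) ≤ if x e then (1 : ℝ) else 0)
    (h4 : ∀ j m, w j (Sum.inr m) ≤ z m) :
    ∀ j, 0 < z j → W j = true := by
  suffices key : ∀ n : ℕ, ∀ j : Fin t, j.val = n → 0 < z j → W j = true from
    fun j => key _ j rfl
  intro n
  induction n using Nat.strong_induction_on with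
  | _ n ih =>
    rintro j rfl hzj
    rw [hW j, hiff]
    refine ⟨(z j)⁻¹ • Yb j, (hYb j).smul (inv_nonneg.2 (hz j)), fun i => ?_⟩
    rw [Matrix.mul_smul, Matrix.trace_smul, smul_eq_mul]
    -- each linearised product is dominated by `z j · [value of the wire]`
    have hu : ∀ a, w j (ref j a) ≤ z j * (if Sum.elim x W (ref j a) then (1 : ℝ) else 0) := by
      intro a
      rcases hr : ref j a with e | m
      · simp only [Sum.elim_inl]
        by_cases hx : x e = true
        · rw [if_pos hx, mul_one]
          exact h2 j (Sum.inl e)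
        · have := h3 j e
          rw [if_neg hx] at this
          rw [if_neg hx, mul_zero]
          exact this
      · simp only [Sum.elim_inr]
        by_cases hWm : W m = true
        · rw [if_pos hWm, mul_one]
          exact h2 j (Sum.inr m)
        · have hm : m < j := href j a m hr
          have hzm : z m ≤ 0 := by
            by_contra hpos
            push Not at hpos
            exact hWm (ih m.val hm m rfl hpos)
          rw [if_neg hWm, mul_zero]
          exact (h4 j m).trans hzm
    have hsum : ∑ a, B j i a * w j (ref j a) ≤
        z j * ∑ a, B j i a * (if Sum.elim x W (ref j a) then (1 : ℝ) else 0) := by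
      rw [Finset.mul_sum]
      refine Finset.sum_le_sum fun a _ => ?_
      calc B j i a * w j (ref j a)
          ≤ B j i a * (z j * (if Sum.elim x W (ref j a) then (1 : ℝ) else 0)) :=
            mul_le_mul_of_nonneg_left (hu a) (hB j i a)
        _ = z j * (B j i a * (if Sum.elim x W (ref j a) then (1 : ℝ) else 0)) := by ring
    have hzj' : (z j)⁻¹ * z j = 1 := inv_mul_cancel₀ hzj.ne'
    calc (z j)⁻¹ * (A j i * Yb j).trace
        ≤ (z j)⁻¹ * (b j i * z j +
            z j * ∑ a, B j i a * (if Sum.elim x W (ref j a) then (1 : ℝ) else 0)) :=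
          mul_le_mul_of_nonneg_left ((h1 j i).trans (by linarith)) (inv_nonneg.2 (hz j))
      _ = b j i + ∑ a, B j i a * (if Sum.elim x W (ref j a) then (1 : ℝ) else 0) := by
          rw [mul_add, show (z j)⁻¹ * (b j i * z j) = b j i * ((z j)⁻¹ * z j) by ring, hzj', mul_one,
            ← mul_assoc, hzj', one_mul]

/-- **Completeness of the homogenised system.** With the same data, the 0/1 point
`zⱼ = [Wⱼ]`, `w_{j,r} = [Wⱼ]·[value of r]`, `Ybⱼ =` (a witness of gate `j` if `Wⱼ`, else `0`)
satisfies all homogenised rows, and `zⱼ = 1` on every true wire. [folklore] -/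
theorem collapse_complete (ar : Fin t → ℕ) (op : (j : Fin t) → (Fin (ar j) → Bool) → Bool)
    (ref : (j : Fin t) → Fin (ar j) → ι ⊕ Fin t)
    (A : Fin t → Fin s₁ → Matrix (Fin s₁) (Fin s₁) ℝ) (b : Fin t → Fin s₁ → ℝ)
    (B : (j : Fin t) → Fin s₁ → Fin (ar j) → ℝ)
    (hiff : ∀ j u, op j u = true ↔ ∃ Y : Matrix (Fin s₁) (Fin s₁) ℝ, Y.PosSemidef ∧
      ∀ i, (A j i * Y).trace ≤ b j i + ∑ a, B j i a * (if u a then (1 : ℝ) else 0))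
    (x : ι → Bool) (W : Fin t → Bool) (hW : ∀ j, W j = op j (fun a => Sum.elim x W (ref j a))) :
    ∃ (z : Fin t → ℝ) (w : Fin t → ι ⊕ Fin t → ℝ) (Yb : Fin t → Matrix (Fin s₁) (Fin s₁) ℝ),
      (∀ j, 0 ≤ z j) ∧ (∀ j r, 0 ≤ w j r) ∧ (∀ j, (Yb j).PosSemidef) ∧
      (∀ j i, (A j i * Yb j).trace ≤ b j i * z j + ∑ a, B j i a * w j (ref j a)) ∧
      (∀ j r, w j r ≤ z j) ∧
      (∀ j e, w j (Sum.inl e) ≤ if x e then (1 : ℝ) else 0) ∧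
      (∀ j m, w j (Sum.inr m) ≤ z m) ∧
      (∀ j, W j = true → z j = 1) := by
  -- gate witnesses on true wires, `0` on false wires
  have hex : ∀ j, ∃ Y : Matrix (Fin s₁) (Fin s₁) ℝ, Y.PosSemidef ∧
      (W j = true → ∀ i, (A j i * Y).trace ≤
        b j i + ∑ a, B j i a * (if Sum.elim x W (ref j a) then (1 : ℝ) else 0)) ∧
      (W j = false → Y = 0) := by
    intro j
    by_cases h : W j = true
    · obtain ⟨Y, hY, hrows⟩ := (hiff j _).1 ((hW j).symm.trans h)
      exact ⟨Y, hY, fun _ => hrows, fun h' => by rw [h] at h'; cases h'⟩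
    · exact ⟨0, Matrix.PosSemidef.zero, fun h' => absurd h' h, fun _ => rfl⟩
  choose Yb hYb hrows hzero using hex
  -- the 0/1 point
  set val : ι ⊕ Fin t → ℝ := fun r => if Sum.elim x W r then 1 else 0 with hval
  set z : Fin t → ℝ := fun j => if W j then 1 else 0 with hz
  have hval0 : ∀ r, 0 ≤ val r := fun r => by simp only [hval]; split_ifs <;> norm_num
  have hval1 : ∀ r, val r ≤ 1 := fun r => by simp only [hval]; split_ifs <;> norm_num
  have hz0 : ∀ j, 0 ≤ z j := fun j => by simp only [hz]; split_ifs <;> norm_num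
  have hz1 : ∀ j, z j ≤ 1 := fun j => by simp only [hz]; split_ifs <;> norm_num
  refine ⟨z, fun j r => z j * val r, Yb, hz0, fun j r => mul_nonneg (hz0 j) (hval0 r), hYb,
    fun j i => ?_, fun j r => ?_, fun j e => ?_, fun j m => ?_, fun j hj => ?_⟩
  · -- gate rows
    by_cases h : W j = true
    · have hzj : z j = 1 := by simp only [hz, h, if_true]
      simp only [hzj, mul_one, one_mul]
      exact hrows j h i
    · have hzj : z j = 0 := by simp only [hz, h]; simp
      have hY : Yb j = 0 := hzero j (by simpa using h)
      simp only [hzj, hY, Matrix.trace_zero, mul_zero, zero_mul,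
        Finset.sum_const_zero, add_zero]
      exact le_refl _
  · -- cap rows
    calc z j * val r ≤ z j * 1 := mul_le_mul_of_nonneg_left (hval1 r) (hz0 j)
      _ = z j := mul_one _
  · -- value rows, input wires
    calc z j * val (Sum.inl e) ≤ 1 * val (Sum.inl e) := mul_le_mul_of_nonneg_right (hz1 j) (hval0 _)
      _ = if x e then 1 else 0 := by rw [one_mul]; rfl
  · -- value rows, gate wires
    calc z j * val (Sum.inr m) ≤ 1 * val (Sum.inr m) := mul_le_mul_of_nonneg_right (hz1 j) (hval0 _)
      _ = z m := by rw [one_mul]; rfl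
  · -- true wires
    simp only [hz, hj, if_true]

end semantics

end Summit.PneNP.PneNP.Theorems
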